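/-
COR-CM (cell pub-hodgecm2) — RSCONJ row Ω (A7, the ω-LABEL face of the μ ↦ μᶜ identification), ROUTE C
(`HOME/d2bridge/ident/ident-1/omega/OMEGA-ROUTE-C.md` §6 (M)): the INSTANCE OF RECORD of Part V at the conjugate hermitian space
`V^{(c)} := HermSpace3.conj V` (RSCONJ row B ✔ `HComp/RecordSystemConjHermSpace`), with the (C3′) label equation DISCHARGED by
✔ `HComp/RecordSystemConjOmegaLabel` (`conjFamily_sChiD_toHeckeCharacter`, pen mukey-p1).
Seat prover-pub-hodgeaudit-ident-1-g4-0 (ident-1 GEN 4), checker ident-2 (whose desk certificate `OmegaAtConjCertificate.lean`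
2d5c07e0f67ac2ed first typed this instance), 2026-08-24.  PART VI (RecordSystemConjOmegaTwistModel).
KERNEL ONLY: two definitions by explicit formula + theorems; no named fact, no instance, no `sorry`.  HC_CM is NOT proved;
HELD — WORLD = C FINAL; nothing displayed by an END is discharged here.
-/
import Summits.HodgeConjecture.CorCM.B01.Transposition.HComp.RecordSystemConjOmegaTwistUniform
import Summits.HodgeConjecture.CorCM.B01.Transposition.HComp.RecordSystemConjOmegaLabel
import Summits.HodgeConjecture.CorCM.B01.Transposition.HComp.RecordSystemConjHermSpace
import HarnessLib

set_option autoImplicit false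

/-!
# The θ-twist of the unitary dual-pair Weil carriers, VI: the instance at the conjugate space `V^{(c)}`

Sequel of `RecordSystemConjOmegaTwistUniform` (Part V: `exists_uniformOmegaRep_conj`, A7 in kernel form at one frame for TWO face
data related by an entrywise-conjugation homomorphism `φ`, modulo the (C3′) label equation `hlabel`).  Here the second face datum is
THE CONJUGATE SPACE OF RECORD: `V′ := V.conj` (row B ✔ `HermSpace3.conj`: Gram `c(H) = Hᵀ`), `φ := (g ↦ ḡ) = HermSpace3.adelicFinConj V`
(`= groupConj F V.Hm`, wb-10 ✔ `finAdelicConj` typed at the two spaces), and the frame identification of `U(V^{(c)})(𝔸_{F⁺,f})` with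
`U(diag dV)(𝔸_{F⁺,f})` INDUCED by the one of `V`:

* `phiConj V Φ Φ′ : 𝔾_V →* 𝔾_{V^{(c)}}` — `g ↦ ḡ` between the two `𝔾(𝔸_F^∞)` of record (`(sec42DataOf … V Φ).G = V.adelicFin` by `rfl`);
* `iotaVConj … ιV : 𝔾_{V^{(c)}} →* U(diag dV)(𝔸_{F⁺,f})`, `ιVᶜ := (c ⊗ 1) ∘ ιV ∘ (g ↦ ḡ)⁻¹`, so that `ιVᶜ (ḡ) = (c ⊗ 1)(ιV g)` BY CONSTRUCTION
  (`iotaVConj_phiConj`) — the `hφ` clause of Part V;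
* the label equation `hlabel` of Part V is mukey-p1's ✔ `conjFamily_sChiD_toHeckeCharacter` (the (C3′) LABEL: the doubling-normalised
  splittings `sChiD` of [GelbartRogawski1991, Prop. 3.1.1] transport under `g ↦ ḡ` to those of the conjugate character);
* **`exists_uniformOmegaRep_conj_hermConj`** — UNCONDITIONAL: for every conjugate-symplectic `ν`, sections `r, r′` with
  `r′_ν(ε′) = −r_{νᶜ}(ε)` and characters `χ′ = χ⁻¹`, the μ-uniform summand of `𝕌_V` ([Liu2021, Def. 4.11 ∕ 4.12] family OF RECORD
  `Model.uniformOmegaRep … V Φ … ιV δ′ r`) at `(νᶜ, ε, χ)` is `ℂ`-LINEARLY isomorphic, equivariantly along `g ↦ ḡ`, to the summand at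
  `(ν, ε′, χ′)` of the μ-uniform family of the CONJUGATE SPACE `𝕌_{V^{(c)}} := uniformOmegaRep … V.conj Φ′ … (iotaVConj … ιV) δ′ r′` on the
  same frame — D_BMM's index relabelling `(μ, ε, χ) ↦ (μᶜ, −ε, χ⁻¹)` along `g ↦ ḡ` as a THEOREM about the tree's objects (no complex
  conjugation of scalars, no contragredient);
What stays print-level after this file: (α) the END at `V^{(c)}` reads its Def-4.11 datum on ITS OWN chosen frame `frameOf V.conj`
(row B: `frameOf V.conj = conjFrame (frameOf V) · frameTwist V`, an explicit unitary — a cross-frame comparison is not stated here);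
(β) that `uniformOmegaRep` transcribes [Liu2021, Def. 4.11] (definition-level, cited).  HC_CM is NOT proved.

References: [Liu2021] Def. 4.11 (l. 2083–2097), Def. 4.12 (l. 2102–2111), Rem. 4.4 (l. 1912–1933), App. D Lem. D.1 (2) (l. 5231);
[GelbartRogawski1991] §3.1 Prop. 3.1.1 p. 455, Remark p. 457; [Kudla1996] V.3; [PlatonovRapinchuk1994] §5.1 (`c ⊗ 1` on adelic points).
-/

noncomputable section

open scoped Matrix
open NumberField IsDedekindDomain
open Literature.NumberTheory.Automorphic Literature.NumberTheory.Automorphic.UnitaryGroup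
open Literature.NumberTheory.Automorphic.IdeleClassGroup
open Literature.NumberTheory.GelbartRogawski1991 Literature.NumberTheory.GelbartRogawski1991.UnitaryDualPair
open Literature.NumberTheory.GelbartRogawski1991.UnitaryDualPair.WeilCoinv
open Literature.AlgebraicGeometry.Motives (CMType)
open Literature.AlgebraicGeometry.ShimuraVarieties.UnitaryCanonicalModel
open Literature.NumberTheory.Automorphic.Liu2021.Def411WeilCarriers (Chi Rep)
open Summit.HodgeConjecture.CorCM.Transposition Summit.HodgeConjecture.CorCM.Transposition.OmegaChiSplitting
open Summit.HodgeConjecture.CorCM.Model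
open Summit.HodgeConjecture.CorCM.D2Bridge.UnitaryGroupConj (finAdelicConj)
open Literature.RepresentationTheory.Liu2021 (isOscillatorChar_toHeckeCharacter_iff)

namespace Summit.HodgeConjecture.CorCM.HComp.OmegaConj

section HermConj

/-- **`φ := g ↦ ḡ`**: row B's `HermSpace3.adelicFinConj V : U(V)(𝔸_{F⁺,f}) ≃ₜ* U(V^{(c)})(𝔸_{F⁺,f})` (`= groupConj F V.Hm`) read as a
homomorphism between the two `𝔾(𝔸_F^∞)` of record, `(sec42DataOf … V Φ).G = V.adelicFin` and `(sec42DataOf … V.conj Φ′).G = V.conj.adelicFin`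
(both `rfl`). [cite: PlatonovRapinchuk1994, §5.1] -/
def phiConj (h : exists_recordSystem) (F : CMField) (ι₁ : F →+* ℂ) (V : HermSpace3 F ι₁) (Φ Φ' : CMType F) :
    (sec42DataOf h isoOf F ι₁ V Φ).G →* (sec42DataOf h isoOf F ι₁ V.conj Φ').G :=
  (HermSpace3.adelicFinConj V).toMulEquiv.toMonoidHom

/-- `phiConj` is `adelicFinConj V` on elements. [folklore] -/
theorem phiConj_apply (h : exists_recordSystem) (F : CMField) (ι₁ : F →+* ℂ) (V : HermSpace3 F ι₁) (Φ Φ' : CMType F) (g : (sec42DataOf h isoOf F ι₁ V Φ).G) :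
    phiConj h F ι₁ V Φ Φ' g = HermSpace3.adelicFinConj V g := rfl

/-- **`ιVᶜ := (c ⊗ 1) ∘ ιV ∘ (g ↦ ḡ)⁻¹ : 𝔾_{V^{(c)}} →* U(diag dV)(𝔸_{F⁺,f})`** — the frame identification of the conjugate space's
group INDUCED by `ιV` (for a real diagonal frame `dV`, `c(diag dV) = diag dV`, hypothesis `hJc`, so wb-10's `finAdelicConj … hJc` is an
automorphism of `U(diag dV)(𝔸_{F⁺,f})`). [cite: PlatonovRapinchuk1994, §5.1] -/
def iotaVConj (h : exists_recordSystem) (F : CMField) (ι₁ : F →+* ℂ) (V : HermSpace3 F ι₁) (Φ Φ' : CMType F) (dV : Fin 3 → F)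
    (ιV : (sec42DataOf h isoOf F ι₁ V Φ).G →*
      UnitaryGroup.finAdelic ↥(maximalRealSubfield F) F (IsCMField.complexConj F) 3 (Matrix.diagonal dV))
    (hJc : (Matrix.diagonal dV).map ((IsCMField.complexConj F : F ≃ₐ[↥(maximalRealSubfield F)] F) : F →+* F) = Matrix.diagonal dV) :
    (sec42DataOf h isoOf F ι₁ V.conj Φ').G →*
      UnitaryGroup.finAdelic ↥(maximalRealSubfield F) F (IsCMField.complexConj F) 3 (Matrix.diagonal dV) :=
  ((finAdelicConj ↥(maximalRealSubfield F) F (IsCMField.complexConj F) 3 hJc).toMulEquiv.toMonoidHom.comp ιV).comp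
    (HermSpace3.adelicFinConj V).symm.toMulEquiv.toMonoidHom

/-- **`ιVᶜ (ḡ) = (c ⊗ 1)(ιV g)`** — the `hφ` clause of Part V holds BY CONSTRUCTION. [folklore] -/
theorem iotaVConj_phiConj (h : exists_recordSystem) (F : CMField) (ι₁ : F →+* ℂ) (V : HermSpace3 F ι₁) (Φ Φ' : CMType F) (dV : Fin 3 → F)
    (ιV : (sec42DataOf h isoOf F ι₁ V Φ).G →*
      UnitaryGroup.finAdelic ↥(maximalRealSubfield F) F (IsCMField.complexConj F) 3 (Matrix.diagonal dV))
    (hJc : (Matrix.diagonal dV).map ((IsCMField.complexConj F : F ≃ₐ[↥(maximalRealSubfield F)] F) : F →+* F) = Matrix.diagonal dV)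
    (g : (sec42DataOf h isoOf F ι₁ V Φ).G) :
    iotaVConj h F ι₁ V Φ Φ' dV ιV hJc (phiConj h F ι₁ V Φ Φ' g) =
      finAdelicConj ↥(maximalRealSubfield F) F (IsCMField.complexConj F) 3 hJc (ιV g) := by
  show finAdelicConj ↥(maximalRealSubfield F) F (IsCMField.complexConj F) 3 hJc
      (ιV ((HermSpace3.adelicFinConj V).symm ((HermSpace3.adelicFinConj V) g))) = _
  rw [ContinuousMulEquiv.symm_apply_apply]

/-- `ιVᶜ k = (c ⊗ 1)(ιV ((g ↦ ḡ)⁻¹ k))` on elements. [folklore] -/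
theorem iotaVConj_apply (h : exists_recordSystem) (F : CMField) (ι₁ : F →+* ℂ) (V : HermSpace3 F ι₁) (Φ Φ' : CMType F) (dV : Fin 3 → F)
    (ιV : (sec42DataOf h isoOf F ι₁ V Φ).G →*
      UnitaryGroup.finAdelic ↥(maximalRealSubfield F) F (IsCMField.complexConj F) 3 (Matrix.diagonal dV))
    (hJc : (Matrix.diagonal dV).map ((IsCMField.complexConj F : F ≃ₐ[↥(maximalRealSubfield F)] F) : F →+* F) = Matrix.diagonal dV)
    (k : (sec42DataOf h isoOf F ι₁ V.conj Φ').G) :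
    iotaVConj h F ι₁ V Φ Φ' dV ιV hJc k =
      finAdelicConj ↥(maximalRealSubfield F) F (IsCMField.complexConj F) 3 hJc (ιV ((HermSpace3.adelicFinConj V).symm k)) := rfl

/-- **A7 AT THE CONJUGATE SPACE OF RECORD — UNCONDITIONAL.**  For the μ-uniform family of record
`𝕌_V := uniformOmegaRep h F ι₁ V Φ e dV hdV hdV0 ιV δ′ r` and the μ-uniform family of the CONJUGATE SPACE on the same frame through `ιVᶜ`,
`𝕌_{V^{(c)}} := uniformOmegaRep h F ι₁ V.conj Φ′ e dV hdV hdV0 (iotaVConj … ιV hJc) δ′ r′`, any conjugate-symplectic `ν`, collections with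
`r′_ν(ε′) = −r_{νᶜ}(ε)` (`hε`) and characters `χ′ = χ⁻¹` (`hχ`):
`∃ Ω : 𝕌_V.omega νᶜ _ ε χ ≃ₗ[ℂ] 𝕌_{V^{(c)}}.omega ν _ ε′ χ′` with `Ω (𝕌_V.rho νᶜ … g x) = 𝕌_{V^{(c)}}.rho ν … ḡ (Ω x)`.
Proof: Part V `exists_uniformOmegaRep_conj` at `φ := phiConj`, `ιV′ := iotaVConj` (`hφ := iotaVConj_phiConj`), `hlabel :=` (C3′)
`conjFamily_sChiD_toHeckeCharacter`.  The representation OF RECORD at label `νᶜ`, index `(ε, χ)`, read along `g ↦ ḡ`, IS the conjugate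
space's own [Liu2021, Def. 4.11] carrier at label `ν` and D_BMM's index `(−ε, χ⁻¹)` — ℂ-linearly.
[cite: Liu2021, Def. 4.11 (l. 2092–2096), Def. 4.12 (l. 2108–2111), Rem. 4.4, App. D Lem. D.1 (2) (l. 5231)] [cite: Kudla1996, V.3] -/
theorem exists_uniformOmegaRep_conj_hermConj (h : exists_recordSystem) (F : CMField) [IsGalois ℚ F] (ι₁ : F →+* ℂ)
    (V : HermSpace3 F ι₁) (Φ Φ' : CMType F) {n : ℕ} (e : Fin 3 × Fin 1 ≃ Fin n) (dV : Fin 3 → F)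
    (ιV : (sec42DataOf h isoOf F ι₁ V Φ).G →*
      UnitaryGroup.finAdelic ↥(maximalRealSubfield F) F (IsCMField.complexConj F) 3 (Matrix.diagonal dV)) (δ' : F)
    (r r' : ∀ μ : Literature.NumberTheory.Automorphic.IdeleClassGroup F →ₜ* Circle,
      IdeleClassGroup.IsConjugateSymplectic F μ → Rep ↥(maximalRealSubfield F) (imagUnitSq F))
    (hdV : ∀ i, IsCMField.complexConj F (dV i) = dV i) (hdV0 : ∀ i, dV i ≠ 0)
    (hJc : (Matrix.diagonal dV).map ((IsCMField.complexConj F : F ≃ₐ[↥(maximalRealSubfield F)] F) : F →+* F) = Matrix.diagonal dV)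
    (ν : Literature.NumberTheory.Automorphic.IdeleClassGroup F →ₜ* Circle) (hν : IdeleClassGroup.IsConjugateSymplectic F ν)
    (ε ε' : Liu2021.Def411WeilCarriers.Eps ↥(maximalRealSubfield F) (imagUnitSq F))
    (hε : (r' ν hν).toFun ε' = -((r (galConj (IsCMField.complexConj F) ν) hν.galConj).toFun ε))
    (χ χ' : Chi ↥(maximalRealSubfield F) F (IsCMField.complexConj F)) (hχ : χ'.1 = χ.1⁻¹) :
    ∃ Ω : (uniformOmegaRep h F ι₁ V Φ e dV hdV hdV0 ιV δ' r).omega (galConj (IsCMField.complexConj F) ν) hν.galConj ε χ ≃ₗ[ℂ]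
        (uniformOmegaRep h F ι₁ V.conj Φ' e dV hdV hdV0 (iotaVConj h F ι₁ V Φ Φ' dV ιV hJc) δ' r').omega ν hν ε' χ',
      ∀ (g : (sec42DataOf h isoOf F ι₁ V Φ).G)
        (x : (uniformOmegaRep h F ι₁ V Φ e dV hdV hdV0 ιV δ' r).omega (galConj (IsCMField.complexConj F) ν) hν.galConj ε χ),
        Ω ((uniformOmegaRep h F ι₁ V Φ e dV hdV hdV0 ιV δ' r).rho (galConj (IsCMField.complexConj F) ν) hν.galConj ε χ g x) =
          (uniformOmegaRep h F ι₁ V.conj Φ' e dV hdV hdV0 (iotaVConj h F ι₁ V Φ Φ' dV ιV hJc) δ' r').rho ν hν ε' χ'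
            (phiConj h F ι₁ V Φ Φ' g) (Ω x) :=
  exists_uniformOmegaRep_conj h F ι₁ V V.conj Φ Φ' e dV hdV hdV0 hJc ιV (iotaVConj h F ι₁ V Φ Φ' dV ιV hJc)
    (phiConj h F ι₁ V Φ Φ') δ' r r' (iotaVConj_phiConj h F ι₁ V Φ Φ' dV ιV hJc) ν hν ε ε' hε χ χ' hχ
    (conjFamily_sChiD_toHeckeCharacter F e dV hdV hdV0 ν (isUnitary_toHeckeCharacter F ν)
      ((isOscillatorChar_toHeckeCharacter_iff ν).mpr hν)
      (isUnitary_toHeckeCharacter F (galConj (IsCMField.complexConj F) ν))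
      ((isOscillatorChar_toHeckeCharacter_iff (galConj (IsCMField.complexConj F) ν)).mpr hν.galConj))

end HermConj

end Summit.HodgeConjecture.CorCM.HComp.OmegaConj

end
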